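import Summits.Ventures.HodgeRepro2.T5AutomorphizeKernel
import Mathlib.MeasureTheory.Measure.Haar.Quotient
import Mathlib.MeasureTheory.Group.Integral

/-!
# T5KernelIdentityPointwise — the unfolding identity `∫_G f(g) v(g⁻¹x) dg = ∫_{G⧸Γ} k(x̄, ȳ) v(ȳ) dȳ`
([DE] Lemma 9.2.3, the pointwise identity)

Cell pub-hodge-repro2, seat p5, Tier 5 (route/T5-N4-p5.md, N4.3 v13 (B1)–(B2)).  Row 57 isolated
the one input of [DE] Theorem 9.2.2 still in prose: that `η(f)` on `L²(G ⧸ Γ)` is the integral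
operator of the kernel `k(x̄, ȳ) = Σ_γ f(x γ⁻¹ y⁻¹)` of row 56.  This file is its POINTWISE form,
Mathlib-only, in Mathlib's conventions — the quotient measure `μ_𝓕 = map mk (μ.restrict 𝓕)` of a
fundamental domain `𝓕` for the right action of a countable `Γ`, `μ` a left-, right- and
inversion-invariant (unimodular) Haar measure on `G`:

* `integral_comp_mul_inv`: the substitution `g = x y⁻¹` in `∫_G` (left and inversion invariance);
* `automorphize_translate_eq_kernelQuot`: `automorphize (y ↦ f (x y⁻¹)) = kernelQuot Γ f x̄` on
  `G ⧸ Γ` (definitional);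
* `integral_eq_integral_kernelQuot`: **the identity** — for `f ∈ C_c(G)`, an essentially bounded
  measurable `v` on `G ⧸ Γ` and EVERY `x ∈ G`,
  `∫ g, f g * v (g⁻¹ x) ∂μ = ∫ ȳ, kernelQuot Γ f x̄ ȳ * v ȳ ∂μ_𝓕`
  (Mathlib's unfolding trick `QuotientGroup.integral_mul_eq_integral_automorphize_mul`);
* `integral_eq_integral_kernelQuot_of_bounded`: the same for a bounded continuous `v`.

What remains for row 57's `KernelIdentity` is the passage from this pointwise identity to the
operator identity in `L²(G ⧸ Γ, μ_𝓕)` (the interchange of the `L²`-valued Bochner integral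
`∫ f(g) ρ(g) v dg` with a.e. evaluation — Fubini on `G × G ⧸ Γ` against a test vector `w`, then
density of the bounded continuous functions).  Mathlib only besides rows 55–56.  Axioms: propext,
Classical.choice, Quot.sound.  README §8(d): uses an L-value-free non-vanishing device: NO.
-/

namespace Summit.Ventures.HodgeRepro2.T5KernelIdentityPointwise

open MeasureTheory Filter Topology
open Summit.Ventures.HodgeRepro2.T5AutomorphizeContinuous
open Summit.Ventures.HodgeRepro2.T5AutomorphizeKernel

variable {G : Type*} [Group G] [MeasurableSpace G] [TopologicalSpace G] [IsTopologicalGroup G]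
  [BorelSpace G] {μ : Measure G} {Γ : Subgroup G}

/-! ### The substitution `g = x y⁻¹` -/

/-- The substitution `g = x y⁻¹` in an integral over `G` (`μ` left- and inversion-invariant):
`∫ y, F (x * y⁻¹) ∂μ = ∫ g, F g ∂μ`. -/
theorem integral_comp_mul_inv [μ.IsMulLeftInvariant] [μ.IsInvInvariant] (F : G → ℂ) (x : G) :
    ∫ y, F (x * y⁻¹) ∂μ = ∫ g, F g ∂μ :=
  calc ∫ y, F (x * y⁻¹) ∂μ = ∫ y, (fun y => F (x * y)) y⁻¹ ∂μ := rfl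
    _ = ∫ y, F (x * y) ∂μ := integral_inv_eq_self (fun y => F (x * y)) μ
    _ = ∫ g, F g ∂μ := integral_mul_left_eq_self F x

/-! ### The automorphization of the translate is the kernel -/

omit [MeasurableSpace G] [TopologicalSpace G] [IsTopologicalGroup G] [BorelSpace G] in
/-- `automorphize (y ↦ f (x y⁻¹)) = kernelQuot Γ f x̄` as functions on `G ⧸ Γ`. -/
theorem automorphize_translate_eq_kernelQuot (f : G → ℂ) (x : G) :
    (QuotientGroup.automorphize (fun y => f (x * y⁻¹)) : G ⧸ Γ → ℂ) =
      kernelQuot Γ f (x : G ⧸ Γ) := by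
  funext y
  exact QuotientGroup.induction_on y fun _ => rfl

omit [MeasurableSpace G] [BorelSpace G] in
/-- The translate `y ↦ f (x y⁻¹)` of `f ∈ C_c(G)` is continuous with compact support. -/
theorem hasCompactSupport_translate {f : G → ℂ} (hfs : HasCompactSupport f) (x : G) :
    HasCompactSupport fun y => f (x * y⁻¹) :=
  hfs.comp_homeomorph ((Homeomorph.inv G).trans (Homeomorph.mulLeft x))

/-! ### The pointwise unfolding identity -/

attribute [-instance] Quotient.instMeasurableSpace

variable [MeasurableSpace (G ⧸ Γ)] [BorelSpace (G ⧸ Γ)] {𝓕 : Set G}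

/-- The quotient measure `μ_𝓕 = map mk (μ.restrict 𝓕)` of a fundamental domain `𝓕`. -/
local notation "μ_𝓕" => Measure.map (@QuotientGroup.mk G _ Γ) (μ.restrict 𝓕)

/-- **The pointwise unfolding identity** ([DE] Lemma 9.2.3): for a fundamental domain `𝓕` of the
right action of a countable `Γ`, a unimodular Haar measure `μ` (left-, right- and
inversion-invariant), `f ∈ C_c(G)`, an essentially bounded measurable `v` on `G ⧸ Γ` and EVERY
`x ∈ G`:  `∫ g, f g * v (g⁻¹ x) ∂μ = ∫ ȳ, kernelQuot Γ f x̄ ȳ * v ȳ ∂μ_𝓕`, where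
`μ_𝓕 = map mk (μ.restrict 𝓕)`. -/
theorem integral_eq_integral_kernelQuot (h𝓕 : IsFundamentalDomain Γ.op 𝓕 μ)
    [Countable Γ] [μ.IsMulLeftInvariant] [μ.IsMulRightInvariant] [μ.IsInvInvariant]
    [IsFiniteMeasureOnCompacts μ]
    [WeaklyLocallyCompactSpace G] [ProperlyDiscontinuousSMul Γ.op G] {f : G → ℂ}
    (hfc : Continuous f) (hfs : HasCompactSupport f) {v : G ⧸ Γ → ℂ}
    (hv : AEStronglyMeasurable v μ_𝓕) (hvb : essSup (fun y => ‖v y‖ₑ) μ_𝓕 ≠ ⊤) (x : G) :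
    ∫ g, f g * v (g⁻¹ * x : G) ∂μ = ∫ y, kernelQuot Γ f (x : G ⧸ Γ) y * v y ∂μ_𝓕 := by
  -- the translate `fx y = f (x y⁻¹)`
  have hfxc : Continuous fun y => f (x * y⁻¹) := hfc.comp (continuous_const.mul continuous_inv)
  have hfxi : Integrable (fun y => f (x * y⁻¹)) μ :=
    hfxc.integrable_of_hasCompactSupport (hasCompactSupport_translate hfs x)
  have hautom : AEStronglyMeasurable
      (QuotientGroup.automorphize (fun y => f (x * y⁻¹)) : G ⧸ Γ → ℂ) μ_𝓕 := by
    rw [automorphize_translate_eq_kernelQuot]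
    have hk : Continuous (kernelQuot Γ f (x : G ⧸ Γ)) :=
      (continuous_kernelQuot (Γ := Γ) hfc hfs).comp
        ((continuous_const (y := (x : G ⧸ Γ))).prodMk continuous_id)
    exact hk.aestronglyMeasurable
  calc ∫ g, f g * v (g⁻¹ * x : G) ∂μ
      = ∫ y, f (x * y⁻¹) * v ((x * y⁻¹)⁻¹ * x : G) ∂μ :=
        (integral_comp_mul_inv (fun g => f g * v (g⁻¹ * x : G)) x).symm
    _ = ∫ y, v (y : G ⧸ Γ) * f (x * y⁻¹) ∂μ := by
        congr 1
        funext y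
        have h : (x * y⁻¹)⁻¹ * x = y := by group
        rw [h, mul_comm]
    _ = ∫ y : G ⧸ Γ, v y * (QuotientGroup.automorphize (fun y => f (x * y⁻¹)) : G ⧸ Γ → ℂ) y
          ∂μ_𝓕 :=
        QuotientGroup.integral_mul_eq_integral_automorphize_mul h𝓕 hfxi hv hvb hautom
    _ = ∫ y, kernelQuot Γ f (x : G ⧸ Γ) y * v y ∂μ_𝓕 := by
        rw [automorphize_translate_eq_kernelQuot]
        congr 1
        funext y
        rw [mul_comm]

/-- The pointwise identity for a BOUNDED CONTINUOUS `v` on `G ⧸ Γ` (measurable, essentially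
bounded by `‖v‖`). -/
theorem integral_eq_integral_kernelQuot_of_bounded
    (h𝓕 : IsFundamentalDomain Γ.op 𝓕 μ) [Countable Γ] [μ.IsMulLeftInvariant]
    [μ.IsMulRightInvariant] [μ.IsInvInvariant] [IsFiniteMeasureOnCompacts μ]
    [WeaklyLocallyCompactSpace G]
    [ProperlyDiscontinuousSMul Γ.op G] {f : G → ℂ} (hfc : Continuous f)
    (hfs : HasCompactSupport f) (v : BoundedContinuousFunction (G ⧸ Γ) ℂ) (x : G) :
    ∫ g, f g * v (g⁻¹ * x : G) ∂μ = ∫ y, kernelQuot Γ f (x : G ⧸ Γ) y * v y ∂μ_𝓕 := by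
  refine integral_eq_integral_kernelQuot h𝓕 hfc hfs v.continuous.aestronglyMeasurable ?_ x
  refine ne_top_of_le_ne_top ENNReal.coe_ne_top (essSup_le_of_ae_le (‖v‖₊ : ENNReal) ?_)
  refine Eventually.of_forall fun y => ?_
  show ‖v y‖ₑ ≤ (‖v‖₊ : ENNReal)
  rw [enorm_eq_nnnorm]
  exact ENNReal.coe_le_coe.2 (v.nnnorm_coe_le_nnnorm y)

end Summit.Ventures.HodgeRepro2.T5KernelIdentityPointwise
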